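import Literature.NumberTheory.EllipticCurves.Sprung2012.ColemanMapJointCokernelProofs
import Literature.NumberTheory.EllipticCurves.Sprung2012.ColemanMapJointInjectiveProofs
import HarnessLib

/-!
# Sprung 2012 Def. 5.9 / Def. 7.1: the joint Coleman map `Col = (Col♯, Col♭) : H¹_Iw(T) → Λ ⊕ Λ` AS A `Λ`-LINEAR MAP of the
# tree's functional model — existence, injectivity, and (modulo one rank clause) cokernel `Λ/(T)` (proofs only)

Topic `Literature/NumberTheory/EllipticCurves`, cluster `Sprung2012` (namespace = path). A THEOREMS file (no definition, no named
fact; net Literature debt `0`). Cell `bsd-ssimc`, width seat `cruxlead-stmt-BirchSwinnertonDyer-19875-w2` (gen 8); `--supports`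
stmt-BirchSwinnertonDyer-22569. PACKAGING for the consumer of item (α) of the F-α discharge list (the cokernel-bound skeleton
`Summits/…/Theorems/SignedLowerHalvesSprungLowerDivisibilityAtThreeCokerBoundSkeleton.lean`, hypotheses `J`, `hJ`, `hcoker`): in
F. E. I. Sprung, *Iwasawa theory for elliptic curves at supersingular primes: A pair of main conjectures*, J. Number Theory **132**
(2012) [Sprung2012], Def. 5.9 (p. 1495) makes `Col : H¹_Iw(T) → Λ ⊕ Λ` a homomorphism of `Λ`-modules and Def. 7.1 (p. 1500) names
its components `(Col♯, Col♭)`; the tree carries `Col` only as the predicate `IsColemanPair … z L♯ L♭` (`ColemanMaps.lean`), with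
existence (`exists_isColemanPair`, Props. 3.9/5.3), uniqueness (`IsColemanPair.unique`, Prop. 5.7), `Λ`-linearity for the DEFINED
action `moduleOfGenerator` (`isColemanPair_lambdaSMul`, `LocalIwasawaModule.lean`), injectivity (`IsColemanPair.functional_unique`,
w3 g6) and the cokernel clause `T·Λ² ⊆ Col(H¹_Iw)` modulo the point-independence clause (IND)
(`forall_exists_isColemanPair_X_mul_rat`, w2 g8) all proved. THIS FILE assembles them into the shape the skeleton consumes,
WITHOUT introducing a definition: under `letI := moduleOfGenerator κ ι W hg`,

* `exists_linearMap_isColemanPair` — **there is a `Λ`-linear `J : H¹_Iw(T) → Λ × Λ` with `Col(z) = J z` for every `z`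
  (`IsColemanPair … z (J z).1 (J z).2`), and `J` is INJECTIVE** (any base field, any `ℤ_p`-extension, any place; `p ∣ a_p`, a Honda
  system);
* `exists_linearMap_isColemanPair_cokernel_rat` — over `ℚ` at an odd good supersingular prime, GIVEN (IND): the same `J` has
  **`T·Λ² ⊆ range J`, hence `ℓ_𝔭(Λ²/range J) = 0` at every prime `𝔭 ∌ T`** — literally the hypotheses `hJ`, `hcoker` of
  `min_lengthAt_quotient_range_le_lengthAt_torsion_of_skeleton` for `P = H¹_Iw(T)` (functional model). Since the image of `J`
  modulo `T` is a line (`IsColemanPair.constantCoeff_eq`), the cokernel is exactly `Λ/(T)`: (SES-KP) `0 → H¹_Iw(T) → Λ² → ℤ_p → 0`.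
HONEST FRAMING: (IND) («`c_{−1}` and `q = ∑_{j<p²} C(j,p) gʲc_2 − 2∑_{j<p} j gʲc_1` are `𝔽_p`-independent in `E(ℚ_∞·ℚ_p)/p`»,
⟺ the level-`2` Honda orbit spans `p²` dimensions mod `p`, ⟸ `Ê(ℚ_{p,2})` free of rank `p²`) is displayed, not proved — see the
module docstring of `ColemanMapJointCokernelProofs.lean`. What remains for F-α beyond this file: the maps `loc : 𝐇¹ → H¹_Iw(T)`,
`toX` with Poitou–Tate exactness (β), Wingberg/Matar (γ), and the identification `C•.colMap = J_• ∘ loc` of the ♯/♭ packages —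
typing tasks. Nothing about any Selmer group, main conjecture or BSD is asserted here.

References: [Sprung2012] Prop. 3.9, Prop. 5.3, Prop. 5.7, Def. 5.9 (pp. 1491–1495), Def. 7.1, Props. 7.3/7.6 (pp. 1500–1501), Thm.
2.2 / Lemma 2.3 (p. 1487); [KuriharaPollack2007] Prop. 1.2; [LeiSujatha2021] §3 (SES-KP); tree `Sprung2012/{ColemanMaps,
ColemanPairExistsProofs, ColemanPairUniqueProofs, LocalIwasawaModule, ColemanMapJointInjectiveProofs, ColemanMapLevelCongruenceProofs,
ColemanMapJointCokernelProofs}.lean`.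
-/

noncomputable section

open scoped Classical NumberField

open Polynomial Finset

universe u

namespace Literature.NumberTheory.EllipticCurves.Sprung2012

open Literature.NumberTheory.EllipticCurves Literature.NumberTheory.GaloisRepresentations ZpExtension
  Literature.NumberTheory.EllipticCurves.Kobayashi2003 Literature.NumberTheory.EllipticCurves.Sprung2017

section Local

variable {K : Type u} [Field K] {p : ℕ} [Fact p.Prime] (κ : ZpExtension K p)
variable {E : Type u} [Field E] [Algebra K E] (ι : AlgebraicClosure K →ₐ[K] AlgebraicClosure E)
variable (W : WeierstrassCurve K)

variable {κ ι W}

/-- **The joint Coleman map as an injective `Λ`-linear map** (Def. 5.9 / 7.1 + Props. 3.9/5.3 (existence), 5.7 (uniqueness),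
the `Λ`-linearity of `isColemanPair_lambdaSMul` and the injectivity `IsColemanPair.functional_unique`): for the `Λ`-module
structure `moduleOfGenerator` on the functionals of `E(K_∞·K_v)` there is a `Λ`-linear `J` with `Col(z) = J z` for all `z`, and
`J` is injective. No definition is introduced (the map is obtained by choice from `exists_isColemanPair`; by uniqueness any two
such maps agree). [cite: Sprung2012, Def. 5.9 and Prop. 5.7 (p. 1495), Def. 7.1 (p. 1500), Prop. 3.9 (p. 1491)] -/
theorem exists_linearMap_isColemanPair {ap : ℤ} (hap : (p : ℤ) ∣ ap) {g : Field.absoluteGaloisGroup E}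
    (hg : κ.IsTopGenerator (resGalOfEmb ι g)) {cneg : localPoints W E} {c : ℕ → localPoints W E}
    (hH : IsHondaSystem κ ι W ap g cneg c) :
    letI := moduleOfGenerator κ ι W hg
    ∃ J : (localTowerPointsOfEmb κ ι W →+ ℤ_[p]) →ₗ[IwasawaAlgebra p] IwasawaAlgebra p × IwasawaAlgebra p,
      (∀ z, IsColemanPair κ ι W ap g c z (J z).1 (J z).2) ∧ Function.Injective J := by
  letI := moduleOfGenerator κ ι W hg
  choose F G hFG using fun z : localTowerPointsOfEmb κ ι W →+ ℤ_[p] ↦ exists_isColemanPair κ ι W hg hap hH z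
  refine ⟨{ toFun := fun z ↦ (F z, G z), map_add' := fun z z' ↦ ?_, map_smul' := fun f z ↦ ?_ }, fun z ↦ hFG z, ?_⟩
  · obtain ⟨h1, h2⟩ := IsColemanPair.unique κ ι W hap (hFG (z + z')) ((hFG z).add (hFG z'))
    exact Prod.ext h1 h2
  · have hs : IsColemanPair κ ι W ap g c (f • z) (f * F z) (f * G z) := by
      rw [moduleOfGenerator_smul_eq]
      exact isColemanPair_lambdaSMul hg hH.2.1 (hFG z) f
    obtain ⟨h1, h2⟩ := IsColemanPair.unique κ ι W hap (hFG (f • z)) hs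
    exact Prod.ext h1 h2
  · intro z z' h
    have h1 : F z = F z' := congrArg Prod.fst h
    have h2 : G z = G z' := congrArg Prod.snd h
    have hz' : IsColemanPair κ ι W ap g c z' (F z) (G z) := by rw [h1, h2]; exact hFG z'
    exact IsColemanPair.functional_unique hg hH (hFG z) hz'

end Local

section Rat

open NumberField IsDedekindDomain

/-- **The joint Coleman map over `ℚ` at an odd supersingular prime, in the shape of the F-α skeleton's hypotheses** (`J`, `hJ`,
`hcoker` of `min_lengthAt_quotient_range_le_lengthAt_torsion_of_skeleton`, `P = H¹_Iw(T)` the functional model with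
`moduleOfGenerator`): GIVEN the point-independence clause (IND) of `forall_exists_isColemanPair_X_mul_rat`, there is an INJECTIVE
`Λ`-linear `J : H¹_Iw(T) → Λ × Λ` with `Col(z) = J z`, with `T·Λ² ⊆ range J`, hence `ℓ_𝔭(Λ²/range J) = 0` at every prime
`𝔭 ∌ T` — the exact sequence (SES-KP) `0 → H¹_Iw(T) → Λ² → ℤ_p → 0` (cokernel exactly `Λ/(T)` by `IsColemanPair.constantCoeff_eq`).
[cite: Sprung2012, Def. 5.9 (p. 1495), Def. 7.1–7.2, Props. 7.3/7.6 (pp. 1500–1501), Thm. 2.2 / Lemma 2.3 (p. 1487)]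
[cite: KuriharaPollack2007, Prop. 1.2] [cite: LeiSujatha2021, §3 (SES-KP)] -/
theorem exists_linearMap_isColemanPair_cokernel_rat (W : WeierstrassCurve ℚ) [W.IsElliptic] [W.IsGloballyMinimal]
    (p : ℕ) [Fact p.Prime] (hp2 : p ≠ 2) (hgood : W.HasGoodReductionAtPrime p) (hap : (p : ℤ) ∣ W.frobeniusTrace p)
    (κ : ZpExtension ℚ p) {v : HeightOneSpectrum (𝓞 ℚ)} (hpv : (p : 𝓞 ℚ) ∈ v.asIdeal)
    {g : Field.absoluteGaloisGroup (v.adicCompletion ℚ)}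
    (hg : κ.IsTopGenerator (resGalOfEmb (closureEmb (K := ℚ) (v.adicCompletion ℚ)) g))
    {cneg : localPoints W (v.adicCompletion ℚ)} {c : ℕ → localPoints W (v.adicCompletion ℚ)}
    (hH : IsHondaSystem κ (closureEmb (K := ℚ) (v.adicCompletion ℚ)) W (W.frobeniusTrace p) g cneg c)
    (hind : ∀ (m₀ m₁ : ℤ) (y : localPoints W (v.adicCompletion ℚ)),
      y ∈ localTowerPointsOfEmb κ (closureEmb (K := ℚ) (v.adicCompletion ℚ)) W →
      p • y = m₀ • cneg + m₁ • (∑ j ∈ range (p ^ 2), (j.choose p) • (g ^ j • c 2) - 2 • ∑ j ∈ range p, j • (g ^ j • c 1)) →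
      (p : ℤ) ∣ m₀ ∧ (p : ℤ) ∣ m₁) :
    letI := moduleOfGenerator κ (closureEmb (K := ℚ) (v.adicCompletion ℚ)) W hg
    ∃ J : (localTowerPointsOfEmb κ (closureEmb (K := ℚ) (v.adicCompletion ℚ)) W →+ ℤ_[p]) →ₗ[IwasawaAlgebra p]
        IwasawaAlgebra p × IwasawaAlgebra p,
      (∀ z, IsColemanPair κ (closureEmb (K := ℚ) (v.adicCompletion ℚ)) W (W.frobeniusTrace p) g c z (J z).1 (J z).2) ∧
      Function.Injective J ∧
      (∀ x y : IwasawaAlgebra p, ∃ z, J z = (PowerSeries.X * x, PowerSeries.X * y)) ∧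
      ∀ 𝔭 : PrimeSpectrum (IwasawaAlgebra p), (PowerSeries.X : IwasawaAlgebra p) ∉ 𝔭.asIdeal →
        Module.lengthAt (IwasawaAlgebra p) ((IwasawaAlgebra p × IwasawaAlgebra p) ⧸ LinearMap.range J) 𝔭 = 0 := by
  letI := moduleOfGenerator κ (closureEmb (K := ℚ) (v.adicCompletion ℚ)) W hg
  obtain ⟨J, hJ, hinj⟩ := exists_linearMap_isColemanPair (κ := κ) (ι := closureEmb (K := ℚ) (v.adicCompletion ℚ)) (W := W)
    hap hg hH
  have hX : ∀ x y : IwasawaAlgebra p, ∃ z, J z = (PowerSeries.X * x, PowerSeries.X * y) := by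
    intro x y
    obtain ⟨z, hz⟩ := forall_exists_isColemanPair_X_mul_rat W p hp2 hgood hap κ hpv hg hH hind x y
    obtain ⟨h1, h2⟩ := IsColemanPair.unique κ (closureEmb (K := ℚ) (v.adicCompletion ℚ)) W hap (hJ z) hz
    exact ⟨z, Prod.ext h1 h2⟩
  exact ⟨J, hJ, hinj, hX, fun 𝔭 h𝔭 ↦ lengthAt_quotient_range_eq_zero_of_forall_X_mul J hX 𝔭 h𝔭⟩

end Rat

end Literature.NumberTheory.EllipticCurves.Sprung2012

end
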